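import Mathlib.RingTheory.Nilpotent.Exp
import Mathlib.Algebra.CharZero.Infinite
import Mathlib.Algebra.Ring.Action.ConjAct
import Mathlib.LinearAlgebra.Dual.Lemmas
import Literature.NumberTheory.Automorphic.RootData
import HarnessLib

/-!
# Exponentials of nilpotent matrices as root homomorphisms (Springer 8.1.1 (i), 10.2.8)

Trunk T-AUTOMORPHIC (G25 AutomorphicL); companion of `LinearAlgebraicGroups.lean` and
`RootData.lean` (namespace `Literature.Automorphic`, concrete `k`-points vocabulary: subgroups
`G, T ≤ GL n k`, algebraic homomorphisms `IsAlgebraicAddHom u` for `u : 𝔾ₐ → G`, root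
homomorphisms `IsRootHom G T hTG α u`, `roots G T`, `rootSubgroup G T α`). In characteristic `0`,
for a nilpotent matrix `A`, Mathlib's finite exponential `IsNilpotent.exp` gives the unipotent
one-parameter group `x ↦ exp (x A)` of `GL n k`; this file proves that it is a **root
homomorphism** for every torus character `α` of which `A` is a weight vector
(`t A t⁻¹ = α(t) A`), inside any subgroup `G ⊇ T` containing its image
(`isRootHom_codRestrict_expHom`). This is the way root subgroups are produced when a reductive
group is *constructed* from a Lie algebra (Springer, *Linear Algebraic Groups*, 2nd ed., 10.2.8:
`Im (x_α) = U_α` for `x_α(ξ) = exp (ξ ad e_α)`; Chevalley's existence theorem 10.1.1, lang.S13 (c)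
`Literature.NumberTheory.Automorphic.chevalley_existence`), the direction opposite to the structure theory of a given group
(`RootSubgroupProofs.lean`); `RootDataGLn.lean` is the special case `A = E_{ij}` (`exp (x E_{ij})`
is the transvection `1 + x E_{ij}`).

* `unipotentExp A hA : GL n k` (`exp A`, inverse `exp (-A)`) and the one-parameter group
  `expHom A hA : Multiplicative k →* GL n k`, `x ↦ exp (x A)` (a homomorphism because the `x A`
  commute, `IsNilpotent.exp_add_of_commute`);
* `exp_smul_matrix_eq_sum`, `exp_smul_apply_eq_eval`: `exp (x A) = ∑_{i<N} xⁱ Aⁱ/i!`, so the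
  entries are polynomials in `x`; `det_exp_smul`: `det exp (x A) = 1` (the determinant is a
  polynomial `D` with `D(x) D(-x) = 1`, hence a unit of `k[X]`, hence the constant `D(0) = 1`);
  `isAlgebraicAddHom_codRestrict_expHom`;
* `exists_retraction_expHom` (the *isomorphism onto a closed subgroup* clause of `IsRootHom`,
  Springer 8.1.1 (i)): for `A ≠ 0` there is a polynomial `q` in the coordinates with
  `q (exp (x A)) = x`, namely `q = ℓ - ℓ(1)` for a linear form `ℓ` with `ℓ(A) = 1` killing the
  higher powers of `A` — which exists because a non-zero nilpotent `A` is not in the span of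
  `A², A³, …` (`not_mem_span_pow_of_isNilpotent`: `A = A² B` would give `A (1 - A B) = 0` with
  `1 - A B` invertible). No logarithm is needed;
* `conj_exp_smul`: `t exp (x A) t⁻¹ = exp (x t A t⁻¹)` (Mathlib `IsNilpotent.exp_smul` for the
  conjugation action `ConjAct`), whence `isRootHom_codRestrict_expHom`, `mem_roots_of_expHom`
  (`α ∈ roots G T` if moreover `α ≠ 1` is algebraic) and `expHom_mem_rootSubgroup`
  (`exp (x A) ∈ U_α`).

## Mathlib

`IsNilpotent.exp` with `exp_add_of_commute`, `exp_mul_exp_neg_self`, `exp_eq_sum`, `exp_smul`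
(`Mathlib/RingTheory/Nilpotent/Exp.lean`), `ConjAct.unitsMulSemiringAction`,
`Submodule.exists_dual_map_eq_bot_of_notMem`, `Matrix.matrix_eq_sum_single`,
`Polynomial.funext`, `Polynomial.isUnit_iff`, `IsNilpotent.isUnit_one_sub`. The tree's
`expGL` (`RealMatrixGroups.lean`) is the *analytic* exponential `NormedSpace.exp` over `ℝ`/`ℂ`;
here everything is algebraic (finite sums, any field of characteristic `0`), hence the distinct
names `unipotentExp`, `expHom`. Mathlib has no algebraic groups; nothing here duplicates a
Mathlib declaration.

## References

* [SpringerLAG1998] T. A. Springer, *Linear Algebraic Groups*, 2nd ed., Progress in Mathematics 9,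
  Birkhäuser (1998): 2.4.5, 8.1.1 (i), 10.1.1, 10.2.8.
-/

noncomputable section

open scoped MatrixGroups
open Polynomial

namespace Literature.NumberTheory.Automorphic

variable {k : Type*} [Field k] [CharZero k] {n : Type*} [Fintype n] [DecidableEq n]

/-! ### The unipotent one-parameter group `x ↦ exp (x A)` -/

section UnipotentExp

/-- `exp A ∈ GL n k` for a nilpotent matrix `A` (inverse `exp (-A)`; Mathlib `IsNilpotent.exp`,
a finite sum in characteristic `0`). [folklore] -/
def unipotentExp (A : Matrix n n k) (hA : IsNilpotent A) : GL n k :=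
  ⟨IsNilpotent.exp A, IsNilpotent.exp (-A), IsNilpotent.exp_mul_exp_neg_self hA,
    IsNilpotent.exp_neg_mul_exp_self hA⟩

/-- The underlying matrix of `unipotentExp A hA` is `exp A`. [folklore] -/
@[simp] lemma coe_unipotentExp (A : Matrix n n k) (hA : IsNilpotent A) :
    ((unipotentExp A hA : GL n k) : Matrix n n k) = IsNilpotent.exp A :=
  rfl

/-- The one-parameter subgroup `x ↦ exp (x A)` of `GL n k` attached to a nilpotent matrix `A`
(a homomorphism `𝔾ₐ → GL n`, since the `x A` commute; Springer 2.4, 10.2.8). [folklore] -/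
def expHom (A : Matrix n n k) (hA : IsNilpotent A) : Multiplicative k →* GL n k where
  toFun x := unipotentExp (x.toAdd • A) (hA.smul x.toAdd)
  map_one' := by
    apply Units.ext
    simp
  map_mul' x y := by
    apply Units.ext
    simp only [coe_unipotentExp, Units.val_mul, toAdd_mul, add_smul]
    exact IsNilpotent.exp_add_of_commute (((Commute.refl A).smul_left _).smul_right _)
      (hA.smul _) (hA.smul _)

/-- The underlying matrix of `expHom A hA x` is `exp (x A)`. [folklore] -/
@[simp] lemma coe_expHom_apply (A : Matrix n n k) (hA : IsNilpotent A) (x : Multiplicative k) :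
    ((expHom A hA x : GL n k) : Matrix n n k) = IsNilpotent.exp (x.toAdd • A) :=
  rfl

variable {A : Matrix n n k}

/-- `exp (x A) = ∑_{i < N} xⁱ (A ^ i / i!)` as soon as `A ^ N = 0`. [folklore] -/
lemma exp_smul_matrix_eq_sum {N : ℕ} (hN : A ^ N = 0) (x : k) :
    IsNilpotent.exp (x • A) = ∑ i ∈ Finset.range N, x ^ i • ((i.factorial : k)⁻¹ • A ^ i) := by
  rw [IsNilpotent.exp_eq_sum (k := N) (by rw [smul_pow, hN, smul_zero])]
  refine Finset.sum_congr rfl fun i _ => ?_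
  rw [smul_pow, smul_comm, ← algebraMap_smul k ((i.factorial : ℚ)⁻¹), map_inv₀, map_natCast]

/-- The entries of `exp (x A)` are polynomials in `x`. [folklore] -/
lemma exp_smul_apply_eq_eval {N : ℕ} (hN : A ^ N = 0) (x : k) (a b : n) :
    IsNilpotent.exp (x • A) a b =
      (∑ i ∈ Finset.range N, C (((i.factorial : k)⁻¹ • A ^ i) a b) * X ^ i).eval x := by
  rw [exp_smul_matrix_eq_sum hN x]
  simp [Matrix.sum_apply, Polynomial.eval_finsetSum, mul_comm]

/-- **`det (exp (x A)) = 1`**: the determinant `D(x)` is a polynomial in `x` with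
`D(x) D(-x) = det 1 = 1`, hence a unit of `k[X]`, hence constant `= D(0) = 1`. [folklore] -/
lemma det_exp_smul (hA : IsNilpotent A) (x : k) : (IsNilpotent.exp (x • A)).det = 1 := by
  obtain ⟨N, hN⟩ := hA
  -- the determinant as a polynomial in `x`
  let M : Matrix n n k[X] :=
    Matrix.of fun a b => ∑ i ∈ Finset.range N, C (((i.factorial : k)⁻¹ • A ^ i) a b) * X ^ i
  have hM : ∀ y : k, M.det.eval y = (IsNilpotent.exp (y • A)).det := by
    intro y
    rw [← Polynomial.coe_evalRingHom, RingHom.map_det]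
    congr 1
    ext a b
    simp [M, exp_smul_apply_eq_eval hN y a b]
  have hMM : ∀ y : k, (M.det * (M.det).comp (-X)).eval y = (1 : k[X]).eval y := by
    intro y
    rw [Polynomial.eval_mul, Polynomial.eval_comp, Polynomial.eval_neg, Polynomial.eval_X, hM,
      hM, ← Matrix.det_mul, neg_smul,
      IsNilpotent.exp_mul_exp_neg_self (IsNilpotent.smul ⟨N, hN⟩ y)]
    simp
  have hunit : IsUnit M.det := IsUnit.of_mul_eq_one _ (Polynomial.funext hMM)
  obtain ⟨r, -, hr⟩ := Polynomial.isUnit_iff.mp hunit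
  have h0 : r = 1 := by
    have h := hM 0
    rw [← hr, Polynomial.eval_C, zero_smul, IsNilpotent.exp_zero, Matrix.det_one] at h
    exact h
  rw [← hM x, ← hr, h0, Polynomial.eval_C]

/-- The one-parameter group `x ↦ exp (x A)`, co-restricted to a subgroup `G` containing its
image, is an *algebraic* homomorphism `𝔾ₐ → G` (`IsAlgebraicAddHom`: entries polynomial in
`x`, and `det⁻¹ = 1`). [folklore] -/
theorem isAlgebraicAddHom_codRestrict_expHom (hA : IsNilpotent A) {G : Subgroup (GL n k)}
    (hG : ∀ x, expHom A hA x ∈ G) : IsAlgebraicAddHom ((expHom A hA).codRestrict G hG) := by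
  obtain ⟨N, hN⟩ := id hA
  refine ⟨Sum.elim (fun ab => ∑ i ∈ Finset.range N, C (((i.factorial : k)⁻¹ • A ^ i) ab.1 ab.2) *
    X ^ i) (fun _ => C 1), fun x c => ?_⟩
  rcases c with ⟨a, b⟩ | ⟨⟩
  · simp only [MonoidHom.codRestrict_apply, glCoordFun_inl, coe_expHom_apply, toAdd_ofAdd,
      Sum.elim_inl]
    exact exp_smul_apply_eq_eval hN x a b
  · simp only [MonoidHom.codRestrict_apply, glCoordFun_inr, coe_expHom_apply, toAdd_ofAdd,
      Sum.elim_inr, Polynomial.eval_C, det_exp_smul hA x, inv_one]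

omit [CharZero k] in
/-- A non-zero nilpotent matrix is linearly independent of its higher powers:
`A ∉ span {A ^ (i + 2)}` (if `A = A² B` with `B` a polynomial in `A` then `A (1 - A B) = 0` with
`1 - A B` invertible). [folklore] -/
lemma not_mem_span_pow_of_isNilpotent (hA : IsNilpotent A) (hA0 : A ≠ 0) :
    A ∉ Submodule.span k (Set.range fun i : ℕ => A ^ (i + 2)) := by
  intro hmem
  have key : ∀ s ∈ Submodule.span k (Set.range fun i : ℕ => A ^ (i + 2)),
      ∃ B : Matrix n n k, Commute A B ∧ s = A ^ 2 * B := by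
    intro s hs
    induction hs using Submodule.span_induction with
    | mem s hs =>
      obtain ⟨i, rfl⟩ := hs
      exact ⟨A ^ i, (Commute.refl A).pow_right i, by rw [← pow_add, add_comm]⟩
    | zero => exact ⟨0, Commute.zero_right A, by simp⟩
    | add s s' _ _ hs hs' =>
      obtain ⟨B, hB, rfl⟩ := hs
      obtain ⟨B', hB', rfl⟩ := hs'
      exact ⟨B + B', hB.add_right hB', by rw [mul_add]⟩
    | smul c s _ hs =>
      obtain ⟨B, hB, rfl⟩ := hs
      exact ⟨c • B, hB.smul_right c, by rw [Matrix.mul_smul]⟩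
  obtain ⟨B, hB, hAB⟩ := key A hmem
  have hnil : IsNilpotent (A * B) := hB.isNilpotent_mul_right hA
  have hu : IsUnit (1 - A * B) := hnil.isUnit_one_sub
  have h0 : A * (1 - A * B) = 0 := by
    rw [mul_sub, mul_one, ← mul_assoc, ← pow_two, ← hAB, sub_self]
  have h1 := congrArg (· * hu.unit⁻¹.val) h0
  simp only [mul_assoc, IsUnit.mul_val_inv, mul_one, zero_mul] at h1
  exact hA0 h1

/-- **A polynomial retraction for `x ↦ exp (x A)`** (`A ≠ 0` nilpotent): there is a polynomial
`q` in the matrix coordinates with `q (exp (x A)) = x` — namely `q(g) = ℓ(g) - ℓ(1)` for a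
linear form `ℓ` on matrices with `ℓ(A) = 1` vanishing on the higher powers of `A`. This is the
"isomorphism onto a closed subgroup" clause of `IsRootHom` (Springer 8.1.1 (i)). [folklore] -/
theorem exists_retraction_expHom (hA : IsNilpotent A) (hA0 : A ≠ 0) :
    ∃ q : MvPolynomial (GLCoord n) k, ∀ x : k,
      MvPolynomial.eval (glCoordFun (expHom A hA (Multiplicative.ofAdd x))) q = x := by
  obtain ⟨N, hN⟩ := id hA
  -- a linear form separating `A` from its higher powers
  obtain ⟨f, hfA, hfS⟩ := Submodule.exists_dual_map_eq_bot_of_notMem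
    (not_mem_span_pow_of_isNilpotent hA hA0) inferInstance
  have hf0 : ∀ i : ℕ, f (A ^ (i + 2)) = 0 := by
    intro i
    have h : f (A ^ (i + 2)) ∈
        Submodule.map f (Submodule.span k (Set.range fun i : ℕ => A ^ (i + 2))) :=
      Submodule.mem_map_of_mem (Submodule.subset_span ⟨i, rfl⟩)
    rwa [hfS, Submodule.mem_bot] at h
  let ℓ : Matrix n n k →ₗ[k] k := (f A)⁻¹ • f
  have hℓA : ℓ A = 1 := by simp [ℓ, inv_mul_cancel₀ hfA]
  have hℓ0 : ∀ i : ℕ, ℓ (A ^ (i + 2)) = 0 := fun i => by simp [ℓ, hf0 i]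
  -- `ℓ` as a polynomial in the coordinates
  refine ⟨(∑ a : n, ∑ b : n, MvPolynomial.C (ℓ (Matrix.single a b 1)) *
      MvPolynomial.X (Sum.inl (a, b))) - MvPolynomial.C (ℓ 1), fun x => ?_⟩
  have hℓg : ∀ g : Matrix n n k, (∑ a : n, ∑ b : n, ℓ (Matrix.single a b 1) * g a b) = ℓ g := by
    intro g
    conv_rhs => rw [Matrix.matrix_eq_sum_single g]
    simp only [map_sum]
    refine Finset.sum_congr rfl fun a _ => Finset.sum_congr rfl fun b _ => ?_
    rw [show Matrix.single a b (g a b) = g a b • Matrix.single a b (1 : k) by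
      rw [Matrix.smul_single, smul_eq_mul, mul_one], map_smul, smul_eq_mul, mul_comm]
  simp only [map_sub, map_sum, map_mul, MvPolynomial.eval_C, MvPolynomial.eval_X, glCoordFun_inl,
    coe_expHom_apply, toAdd_ofAdd]
  rw [hℓg, exp_smul_matrix_eq_sum (N := N + 2) (by rw [pow_add, hN, zero_mul]) x, map_sum,
    Finset.sum_range_succ', Finset.sum_range_succ']
  simp only [map_smul, hℓ0, zero_add, pow_one,
    Nat.factorial_one, Nat.cast_one, inv_one, one_smul, hℓA, smul_eq_mul, mul_one, pow_zero,
    Nat.factorial_zero]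
  simp

/-- Conjugating `exp (x A)` by an invertible matrix exponentiates the conjugate. [folklore] -/
lemma conj_exp_smul (hA : IsNilpotent A) (t : GL n k) (x : k) :
    (t : Matrix n n k) * IsNilpotent.exp (x • A) * ((t⁻¹ : GL n k) : Matrix n n k) =
      IsNilpotent.exp (x • ((t : Matrix n n k) * A * ((t⁻¹ : GL n k) : Matrix n n k))) := by
  have h := (IsNilpotent.exp_smul (ConjAct.toConjAct t) (hA.smul x)).symm
  rw [ConjAct.units_smul_def, ConjAct.units_smul_def, ConjAct.ofConjAct_toConjAct] at h
  rw [h, Matrix.mul_smul, Matrix.smul_mul]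

end UnipotentExp

/-! ### Root homomorphisms from nilpotent weight vectors -/

section RootHom

variable {G T : Subgroup (GL n k)} {A : Matrix n n k}

/-- **Exponentials of nilpotent weight vectors are root homomorphisms.** Let `T ≤ G ≤ GL n k`
(characteristic `0`), `A ≠ 0` a nilpotent matrix with `exp (x A) ∈ G` for all `x`, and `α` a
character of `T` with `t A t⁻¹ = α(t) A` for `t ∈ T` (a weight vector of weight `α` for
`Ad T`). Then `u(x) = exp (x A)` is a root homomorphism of `G` relative to `T` with character
`α` (`IsRootHom`: algebraic, with a polynomial retraction, and `t u(x) t⁻¹ = u(α(t) x)`).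
This is how the root subgroups of the groups of Springer 10.2.8 arise (`x_α(ξ) = exp (ξ ad e_α)`).
[cite: SpringerLAG1998, 8.1.1 (i) and 10.2.8] -/
theorem isRootHom_codRestrict_expHom (hTG : T ≤ G) (hA : IsNilpotent A) (hA0 : A ≠ 0)
    (hG : ∀ x, expHom A hA x ∈ G) {α : ↥T →* kˣ}
    (hconj : ∀ t : ↥T,
      ((t : GL n k) : Matrix n n k) * A * (((t : GL n k)⁻¹ : GL n k) : Matrix n n k) =
        ((α t : kˣ) : k) • A) :
    IsRootHom G T hTG α ((expHom A hA).codRestrict G hG) := by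
  refine ⟨isAlgebraicAddHom_codRestrict_expHom hA hG, exists_retraction_expHom hA hA0,
    fun t x => ?_⟩
  apply Subtype.ext
  apply Units.ext
  simp only [Subgroup.coe_mul, Subgroup.coe_inv, Subgroup.coe_inclusion,
    MonoidHom.codRestrict_apply, Units.val_mul, coe_expHom_apply, toAdd_ofAdd]
  rw [conj_exp_smul hA, hconj t, smul_smul, mul_comm x]

/-- Hence such an `α`, if non-trivial and algebraic, is a root of `(G, T)`, and `exp (x A)` lies
in the root subgroup `U_α`. [cite: SpringerLAG1998, 8.1.1 (i)] -/
theorem mem_roots_of_expHom (hTG : T ≤ G) (hA : IsNilpotent A) (hA0 : A ≠ 0)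
    (hG : ∀ x, expHom A hA x ∈ G) {α : ↥(characterLattice T)} (hα : (α : ↥T →* kˣ) ≠ 1)
    (hconj : ∀ t : ↥T,
      ((t : GL n k) : Matrix n n k) * A * (((t : GL n k)⁻¹ : GL n k) : Matrix n n k) =
        (((α : ↥T →* kˣ) t : kˣ) : k) • A) :
    α ∈ roots G T :=
  ⟨hα, hTG, _, isRootHom_codRestrict_expHom hTG hA hA0 hG hconj⟩

/-- In the same situation `exp (x A) ∈ U_α = rootSubgroup G T α`.
[cite: SpringerLAG1998, 8.1.1 (i)] -/
theorem expHom_mem_rootSubgroup (hTG : T ≤ G) (hA : IsNilpotent A) (hA0 : A ≠ 0)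
    (hG : ∀ x, expHom A hA x ∈ G) {α : ↥T →* kˣ}
    (hconj : ∀ t : ↥T,
      ((t : GL n k) : Matrix n n k) * A * (((t : GL n k)⁻¹ : GL n k) : Matrix n n k) =
        ((α t : kˣ) : k) • A) (x : Multiplicative k) :
    expHom A hA x ∈ rootSubgroup G T α := by
  refine Subgroup.mem_iSup_of_mem hTG (Subgroup.mem_iSup_of_mem ((expHom A hA).codRestrict G hG)
    (Subgroup.mem_iSup_of_mem (isRootHom_codRestrict_expHom hTG hA hA0 hG hconj) ?_))
  exact ⟨(expHom A hA).codRestrict G hG x, ⟨x, rfl⟩, rfl⟩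

end RootHom

end Literature.NumberTheory.Automorphic
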